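import Literature.AlgebraicGeometry.Motives.KunnethH1ProductCoverProofs
import Literature.AlgebraicGeometry.Morphisms.CechH1PullbackComp
import Mathlib.CategoryTheory.Monoidal.Cartesian.Over
import HarnessLib

/-!
# Künneth injectivity for `Ȟ¹(𝒪)` on the fibres `(X ×_K Y) ×_K Spec κ` over field-valued points

`Motives/KunnethH1Slices` records (and `Motives/KunnethH1ProductCoverProofs` proves,
`kunneth_cechH1_slices_injective_holds`) the Künneth injectivity used in the proof of the theorem
of the cube (Görtz–Wedhorn II, Thm. 24.73, p. 550, via Cor. 22.110 and Thm. 22.9): for `X`, `Y`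
proper geometrically integral over a field `k` with `k`-points `x`, `y` and any covering `𝒰` of
`X ×_k Y` by affine opens, a class in `Ȟ¹(𝒰, 𝒪_{X ×_k Y})` dying on the slices `{x} × Y` and
`X × {y}` is zero. Step (I) of the proof of Lemma 24.72 (p. 548) consumes this statement not for
`X ×_K Y` itself but for the FIBRES of `(X ×_K Y) ×_K T → T` over the points `t ∈ T`, i.e. for
`(X ×_K Y) ×_K Spec κ(t) = X_{κ(t)} ×_{κ(t)} Y_{κ(t)}` ("for all `t ∈ T` this map is of the form
`H¹(X_s ×_{κ(s)} Y_s) ⊗_{κ(s)} κ(t) → …`", p. 550; here `S = Spec K`, so the fibre over `t` is the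
product over `κ(t)` of the base changes `X_{κ(t)}`, `Y_{κ(t)}`, again proper and geometrically
integral, with the `κ(t)`-points induced by `x`, `y`).

This file performs that transport, with Mathlib's monoidal structure on the base-change functor
`Over.pullback σ : Over (Spec K) ⥤ Over (Spec κ)` along a morphism `σ : Spec κ → Spec K`
(`Mathlib.CategoryTheory.Monoidal.Cartesian.Over`: `Functor.Monoidal (Over.pullback σ)`, the
tensorator `μ : σ^*X ⊗ σ^*Y ≅ σ^*(X ⊗ Y)` and unit `ε : 𝟙 ≅ σ^*𝟙`):

* `ptBC σ x : 𝟙 ⟶ σ^*X` — the `κ`-point of `X_κ = σ^*X` induced by a `K`-point `x` (`ε ≫ σ^*x`);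
* `sliceLeft_bc`, `sliceRight_bc` — the slices `{x_κ} × Y_κ`, `X_κ × {y_κ}` of `X_κ ⊗ Y_κ`
  followed by `μ` are the base changes `σ^*({x} × Y)`, `σ^*(X × {y})` of the slices of `X ⊗ Y`
  (naturality and unitality of `μ`);
* `kunneth_cechH1_bc_slices_injective` — **Künneth injectivity on `σ^*(X ⊗ Y)`**: for any
  covering `𝒰` of `σ^*(X ×_K Y) = (X ×_K Y) ×_K Spec κ` by affine opens, a class
  `c ∈ Ȟ¹(𝒰, 𝒪)` whose pullbacks along `σ^*({x} × Y)` and `σ^*(X × {y})` vanish is zero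
  (pull `c` back along the isomorphism `μ`, apply `kunneth_cechH1_slices_injective_holds` to
  `σ^*X`, `σ^*Y` over `κ`, and return along `μ⁻¹`; functoriality of `Ȟ¹` from
  `Morphisms/CechH1PullbackComp`);
* `kunneth_cechH1_fibre_slices_injective` — the same statement in the language of the cube files
  (`Motives/SeesawTheorem`, `Motives/ThickeningModel`): for the `K`-scheme `S = (Spec κ → Spec K)`
  (e.g. `residuePt T t`, `modelPt T hB κ(t)`), the scheme `((X ⊗ Y) ⊗ S).left` over `Spec κ` via
  `snd`, and the slices `({x} × Y) ▷ S`, `(X × {y}) ▷ S`.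

Everything is proved; no new named fact. Mathlib searched (pin): `Over.pullback`,
`Over.pullback_map_left`, `Functor.Monoidal.μIso`, `Functor.LaxMonoidal.μ_natural_left/right`,
`Functor.LaxMonoidal.left_unitality_inv`, `right_unitality_inv`, `Over.whiskerRight_left`,
`IsAffineOpen.preimage`, `Scheme.Hom.preimage_iSup` (used); Mathlib has no Čech cohomology.

## References

* U. Görtz, T. Wedhorn, *Algebraic Geometry II: Cohomology of Schemes*, Springer Spektrum (2023),
  doi:10.1007/978-3-658-43031-3: Cor. 22.110, p. 399; Lemma 24.72, proof, Step (I), p. 548;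
  Thm. 24.73 and its proof, p. 550 (read via the held copy). [GortzWedhorn2023]
* U. Görtz, T. Wedhorn, *Algebraic Geometry I: Schemes*, 2nd ed. (2020): (4.7)–(4.8), base change
  and fibre products, pp. 101–105. [GortzWedhorn2020]
-/

universe u

open CategoryTheory CategoryTheory.Limits AlgebraicGeometry MonoidalCategory
open CartesianMonoidalCategory
open Literature.AlgebraicGeometry.Morphisms

noncomputable section

namespace Literature.AlgebraicGeometry.Motives

variable {K : Type u} [Field K] {κ : Type u} [Field κ] (σ : Spec (.of κ) ⟶ Spec (.of K))

/-! ### Base change along `σ : Spec κ → Spec K` and rational points -/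

/-- The base change `X ↦ X_κ = X ×_K Spec κ` along a morphism `σ : Spec κ → Spec K`, as Mathlib's
monoidal functor `Over.pullback σ : Over (Spec K) ⥤ Over (Spec κ)` (Görtz–Wedhorn I, (4.7)).
[folklore] -/
abbrev fieldBC : SchemeOver K ⥤ SchemeOver κ := Over.pullback σ

/-- `X_κ → Spec κ` is proper for `X → Spec K` proper (base change). [folklore] -/
instance isProper_fieldBC_obj_hom (X : SchemeOver K) [IsProper X.hom] :
    IsProper ((fieldBC σ).obj X).hom :=
  inferInstanceAs (IsProper (pullback.snd X.hom σ))

/-- `X_κ → Spec κ` is geometrically integral for `X → Spec K` geometrically integral (base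
change). [folklore] -/
instance geometricallyIntegral_fieldBC_obj_hom (X : SchemeOver K) [GeometricallyIntegral X.hom] :
    GeometricallyIntegral ((fieldBC σ).obj X).hom :=
  inferInstanceAs (GeometricallyIntegral (pullback.snd X.hom σ))

/-- **The `κ`-point `x_κ` of `X_κ` induced by a `K`-point `x` of `X`**: `Spec κ ≅ (Spec K)_κ → X_κ`
(the unit `ε` of the monoidal structure of base change followed by `σ^*x`). [folklore] -/
def ptBC {X : SchemeOver K} (x : 𝟙_ (SchemeOver K) ⟶ X) :
    𝟙_ (SchemeOver κ) ⟶ (fieldBC σ).obj X :=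
  Functor.LaxMonoidal.ε (fieldBC σ) ≫ (fieldBC σ).map x

/-- **The slice `{x_κ} × Y_κ → X_κ ×_κ Y_κ` is the base change of the slice `{x} × Y → X ×_K Y`**
(up to the tensorator `μ : X_κ ⊗ Y_κ ≅ (X ⊗ Y)_κ`; naturality and left unitality of `μ`).
[folklore] -/
theorem sliceLeft_bc {X : SchemeOver K} (x : 𝟙_ (SchemeOver K) ⟶ X) (Y : SchemeOver K) :
    ((λ_ ((fieldBC σ).obj Y)).inv ≫ ptBC σ x ▷ (fieldBC σ).obj Y) ≫
        Functor.LaxMonoidal.μ (fieldBC σ) X Y =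
      (fieldBC σ).map ((λ_ Y).inv ≫ x ▷ Y) := by
  rw [ptBC, comp_whiskerRight, Category.assoc, Category.assoc,
    Functor.LaxMonoidal.μ_natural_left, Functor.LaxMonoidal.left_unitality_inv_assoc,
    ← Functor.map_comp]

/-- **The slice `X_κ × {y_κ} → X_κ ×_κ Y_κ` is the base change of the slice `X × {y} → X ×_K Y`**
(naturality and right unitality of `μ`). [folklore] -/
theorem sliceRight_bc (X : SchemeOver K) {Y : SchemeOver K} (y : 𝟙_ (SchemeOver K) ⟶ Y) :
    ((ρ_ ((fieldBC σ).obj X)).inv ≫ (fieldBC σ).obj X ◁ ptBC σ y) ≫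
        Functor.LaxMonoidal.μ (fieldBC σ) X Y =
      (fieldBC σ).map ((ρ_ X).inv ≫ X ◁ y) := by
  rw [ptBC, MonoidalCategory.whiskerLeft_comp, Category.assoc, Category.assoc,
    Functor.LaxMonoidal.μ_natural_right, Functor.LaxMonoidal.right_unitality_inv_assoc,
    ← Functor.map_comp]

/-! ### Künneth injectivity on `σ^*(X ⊗ Y)` -/

/-- **Künneth injectivity for `Ȟ¹(𝒪)` on `(X ×_K Y) ×_K Spec κ = X_κ ×_κ Y_κ`** (Görtz–Wedhorn II,
proof of Thm. 24.73, p. 550: for every `t`, `H¹(X_s ×_{κ(s)} Y_s) ⊗ κ(t) → H¹(Y_s) ⊗ κ(t) ⊕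
H¹(X_s) ⊗ κ(t)` is injective by the Künneth formula — applied here to the base changes `X_κ`,
`Y_κ`, proper geometrically integral over `κ` with the `κ`-points `x_κ`, `y_κ`): for `X`, `Y`
proper geometrically integral `K`-schemes with `K`-points `x`, `y`, a morphism
`σ : Spec κ → Spec K` from the spectrum of a field, any covering `𝒰` of `σ^*(X ×_K Y)` by affine
opens and `c ∈ Ȟ¹(𝒰, 𝒪)`: if the pullbacks of `c` along the base-changed slices
`σ^*({x} × Y) : Y_κ → (X × Y)_κ` and `σ^*(X × {y}) : X_κ → (X × Y)_κ` vanish, then `c = 0`.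
Proof: transport along the isomorphism `μ : X_κ ⊗ Y_κ ≅ (X ⊗ Y)_κ` (`sliceLeft_bc`,
`sliceRight_bc`) and `kunneth_cechH1_slices_injective_holds`.
[cite: GortzWedhorn2023, Thm. 24.73 proof p. 550 with Cor. 22.110 p. 399] -/
theorem kunneth_cechH1_bc_slices_injective (X Y : SchemeOver K) [IsProper X.hom] [IsProper Y.hom]
    [GeometricallyIntegral X.hom] [GeometricallyIntegral Y.hom]
    (x : 𝟙_ (SchemeOver K) ⟶ X) (y : 𝟙_ (SchemeOver K) ⟶ Y) {ι : Type u}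
    (U : ι → ((fieldBC σ).obj (X ⊗ Y)).left.Opens) (hU : ∀ i, IsAffineOpen (U i))
    (hcov : ⨆ i, U i = ⊤) (c : CechH1 ((fieldBC σ).obj (X ⊗ Y)).hom U)
    (hx : cechComapH1 ((fieldBC σ).obj (X ⊗ Y)).hom ((fieldBC σ).obj Y).hom
        ((fieldBC σ).map ((λ_ Y).inv ≫ x ▷ Y)).left (Over.w _) U c = 0)
    (hy : cechComapH1 ((fieldBC σ).obj (X ⊗ Y)).hom ((fieldBC σ).obj X).hom
        ((fieldBC σ).map ((ρ_ X).inv ≫ X ◁ y)).left (Over.w _) U c = 0) :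
    c = 0 := by
  -- the tensorator `μ : X_κ ⊗ Y_κ ≅ (X ⊗ Y)_κ` and its inverse, on underlying schemes
  let μ : (fieldBC σ).obj X ⊗ (fieldBC σ).obj Y ≅ (fieldBC σ).obj (X ⊗ Y) :=
    Functor.Monoidal.μIso (fieldBC σ) X Y
  have hμ : μ.hom.left ≫ ((fieldBC σ).obj (X ⊗ Y)).hom = ((fieldBC σ).obj X ⊗ (fieldBC σ).obj Y).hom :=
    Over.w μ.hom
  have hμ' : μ.inv.left ≫ ((fieldBC σ).obj X ⊗ (fieldBC σ).obj Y).hom = ((fieldBC σ).obj (X ⊗ Y)).hom :=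
    Over.w μ.inv
  haveI : IsIso μ.hom.left := inferInstanceAs (IsIso ((Over.forget _).map μ.hom))
  -- the class pulled back to `X_κ ⊗ Y_κ` vanishes by Künneth over `κ`
  have hc' : cechComapH1 _ _ μ.hom.left hμ U c = 0 := by
    refine kunneth_cechH1_slices_injective_holds κ ((fieldBC σ).obj X) ((fieldBC σ).obj Y)
      (ptBC σ x) (ptBC σ y) ι (preimageFamily μ.hom.left U) (fun i => (hU i).preimage μ.hom.left)
      ?_ _ ?_ ?_
    · change ⨆ i, μ.hom.left ⁻¹ᵁ U i = ⊤
      rw [← Scheme.Hom.preimage_iSup, hcov, Scheme.Hom.preimage_top]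
    · have e : ((λ_ ((fieldBC σ).obj Y)).inv ≫ ptBC σ x ▷ (fieldBC σ).obj Y).left ≫ μ.hom.left =
          ((fieldBC σ).map ((λ_ Y).inv ≫ x ▷ Y)).left := by
        rw [← Over.comp_left, Functor.Monoidal.μIso_hom, sliceLeft_bc]
      exact (cechComapH1_comp _ _ _ μ.hom.left
        ((λ_ ((fieldBC σ).obj Y)).inv ≫ ptBC σ x ▷ (fieldBC σ).obj Y).left U hμ (Over.w _) c).trans
          ((cechComapH1_congr_eq_zero_iff _ U e _ (Over.w _) c).2 hx)
    · have e : ((ρ_ ((fieldBC σ).obj X)).inv ≫ (fieldBC σ).obj X ◁ ptBC σ y).left ≫ μ.hom.left =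
          ((fieldBC σ).map ((ρ_ X).inv ≫ X ◁ y)).left := by
        rw [← Over.comp_left, Functor.Monoidal.μIso_hom, sliceRight_bc]
      exact (cechComapH1_comp _ _ _ μ.hom.left
        ((ρ_ ((fieldBC σ).obj X)).inv ≫ (fieldBC σ).obj X ◁ ptBC σ y).left U hμ (Over.w _) c).trans
          ((cechComapH1_congr_eq_zero_iff _ U e _ (Over.w _) c).2 hy)
  -- return along `μ⁻¹`: `c = (μ⁻¹ ≫ μ)^* c = (μ⁻¹)^* μ^* c = 0`
  have e1 : μ.inv.left ≫ μ.hom.left = 𝟙 _ := by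
    rw [← Over.comp_left, Iso.inv_hom_id, Over.id_left]
  have key : cechComapH1 _ _ (μ.inv.left ≫ μ.hom.left)
      (comp_comp_eq _ _ _ μ.hom.left μ.inv.left hμ hμ') U c = 0 := by
    rw [← cechComapH1_comp _ _ _ μ.hom.left μ.inv.left U hμ hμ', hc']
    exact map_zero _
  rw [cechComapH1_congr_eq_zero_iff _ U e1 _ (Category.id_comp _) c, cechComapH1_id] at key
  exact key

/-! ### The fibre form: `((X ⊗ Y) ⊗ S).left` for `S = (Spec κ → Spec K)` -/

/-- The `K`-scheme `Spec κ → Spec K`. [folklore] -/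
abbrev fieldPt : SchemeOver K := Over.mk σ

/-- The underlying scheme of `P ⊗ (Spec κ → Spec K)` is that of `σ^*P` (both are
`P ×_{Spec K} Spec κ`; definitional). [folklore] -/
theorem tensorObj_fieldPt_left (P : SchemeOver K) :
    (P ⊗ fieldPt σ).left = ((fieldBC σ).obj P).left := rfl

/-- The projection `P ⊗ (Spec κ → Spec K) → Spec κ` is the structure morphism of `σ^*P`
(definitional). [folklore] -/
theorem snd_fieldPt_left (P : SchemeOver K) :
    (snd P (fieldPt σ)).left = ((fieldBC σ).obj P).hom := rfl

/-- For a `K`-morphism `q : P' → P`, the morphism `q ▷ (Spec κ → Spec K)` on underlying schemes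
is `σ^*q` (definitionally). [folklore] -/
theorem whiskerRight_fieldPt_left {P' P : SchemeOver K} (q : P' ⟶ P) :
    (q ▷ fieldPt σ).left =
      (((fieldBC σ).map q).left : (P' ⊗ fieldPt σ).left ⟶ (P ⊗ fieldPt σ).left) :=
  rfl

/-- `(q ▷ S) ≫ pr_S = pr_S` on underlying schemes. [folklore] -/
theorem whiskerRight_left_comp_snd_left {P' P : SchemeOver K} (q : P' ⟶ P) (S : SchemeOver K) :
    (q ▷ S).left ≫ (snd P S).left = (snd P' S).left := by
  rw [← Over.comp_left, whiskerRight_snd]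

/-- **Künneth injectivity for `Ȟ¹(𝒪)` on the fibre `(X ×_K Y) ×_K Spec κ`, cube form**
(Görtz–Wedhorn II, proof of Thm. 24.73, p. 550, as consumed by Lemma 24.72, Step (I), p. 548):
for `X`, `Y` proper geometrically integral `K`-schemes with `K`-points `x`, `y`, the `K`-scheme
`S = (Spec κ → Spec K)` of a field-valued point (e.g. `residuePt T t`, `modelPt T hB κ(t)` of the
cube files), any covering `𝒰` of `((X ⊗ Y) ⊗ S).left = (X ×_K Y) ×_K Spec κ` by affine opens, and
a class `c ∈ Ȟ¹(𝒰, 𝒪)` (a `κ`-vector space through `snd : (X ⊗ Y) ⊗ S → S = Spec κ`): if the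
pullbacks of `c` along the slices `({x} × Y) ▷ S : (Y ⊗ S).left → ((X ⊗ Y) ⊗ S).left` and
`(X × {y}) ▷ S` vanish, then `c = 0`.
[cite: GortzWedhorn2023, Thm. 24.73 proof p. 550 with Cor. 22.110 p. 399] -/
theorem kunneth_cechH1_fibre_slices_injective (X Y : SchemeOver K) [IsProper X.hom]
    [IsProper Y.hom] [GeometricallyIntegral X.hom] [GeometricallyIntegral Y.hom]
    (x : 𝟙_ (SchemeOver K) ⟶ X) (y : 𝟙_ (SchemeOver K) ⟶ Y) {ι : Type u}
    (U : ι → ((X ⊗ Y) ⊗ fieldPt σ).left.Opens) (hU : ∀ i, IsAffineOpen (U i))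
    (hcov : ⨆ i, U i = ⊤) (c : CechH1 (snd (X ⊗ Y) (fieldPt σ)).left U)
    (hx : cechComapH1 (snd (X ⊗ Y) (fieldPt σ)).left (snd Y (fieldPt σ)).left
        (((λ_ Y).inv ≫ x ▷ Y) ▷ fieldPt σ).left
        (whiskerRight_left_comp_snd_left _ _) U c = 0)
    (hy : cechComapH1 (snd (X ⊗ Y) (fieldPt σ)).left (snd X (fieldPt σ)).left
        (((ρ_ X).inv ≫ X ◁ y) ▷ fieldPt σ).left
        (whiskerRight_left_comp_snd_left _ _) U c = 0) :
    c = 0 :=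
  kunneth_cechH1_bc_slices_injective σ X Y x y U hU hcov c
    ((cechComapH1_congr_eq_zero_iff _ U (whiskerRight_fieldPt_left σ _) _ (Over.w _) c).1 hx)
    ((cechComapH1_congr_eq_zero_iff _ U (whiskerRight_fieldPt_left σ _) _ (Over.w _) c).1 hy)

end Literature.AlgebraicGeometry.Motives

end
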